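import Literature.Probability.LatticeModels.StarComponents
import Literature.Probability.LatticeModels.StarBoundaryBox
import Literature.Probability.LatticeModels.RCBoxAmbient
import Literature.Probability.LatticeModels.RandomClusterShiftedBoxes
import Literature.Probability.Percolation.KestenZhangPeierls
import HarnessLib

/-!
# FK-continuity cell, FO-10a: THE WHITE `★`-SLEEVE, II — the black cluster of a far shell (Grimmett's `B(∂Δ)` on the
# `★`-lattice), its `★`-connectedness, the interior, and the black `★`-animal carried by a long black chain

Claimed R42 (8)(c) in the cell INBOX at 2026-08-27T01:41:06Z by fkp-10a gen 347 under provision (ι) (coordinator unit fk-4 lapsed 2026-08-26T11:30Z; g242 re-seated 20:28Z–23:50Z 2026-08-26 and closed l.7916; the lane lead absorbs the registry word; silence = consent); lineage row FO-10a-g347, package g347-uniqueness, label UQ-B.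
Cell `fk-continuity` (bschramm), row FO-10a; support file for the FK-continuity transplant
(`--supports stmt-CriticalPhenomena-4575`); builds on p205010 (kernel theorem, internal audit signed; external expert
review pending). Pure proofs; no definitions, no named facts, no sorries; standard axioms. Deterministic (no
measure); companion of `WhiteSleeveWiring.lean` (independent of it).

Grimmett 2006, §5.3, proof of Thm. (5.33)(b) (p. 108): for a set `V` of vertices the BLACK CLUSTER `B(V)` is `V`
together with every `x₀` joined to `V` by a path of the `★`-lattice `𝓛` all of whose vertices off `V` are black; the
proof works with `B(∂Δ)` for a large box `Δ`. Here, with `B` an ARBITRARY set of "black" sites (instantiated downstream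
with the block colouring `{w | ∃ e ∈ edgesTouching (zdGraph d) (starBall w), e ∉ ω}`) and `N` the radius of the explored
box `Λ_N`:

* `Bk = {w | w ∉ Λ_N ∨ w ∈ B}` ("black or outside") and the **black cluster of the shell `Λ_{N+1} ∖ Λ_N`**:
  `S = {z ∈ Λ_{N+1} | ∃ y ∉ Λ_N, z ⇝ y through Bk}` — in the lemmas a hypothesis `hS : ∀ z, z ∈ S ↔ …` on a finset `S`
  (no definition is introduced); `S` contains the shell and the black sites of `Λ_N` `★`-chained through black sites to it;
* first-exit of `★`-chains (`exists_starRel_exit`); the shell is `★`-connected (`starConn_shell`, Lemma B.82 for a box);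
  **`S` is `★`-connected** (`starConn_blackCluster`: stop each black chain at its first exit from `Λ_N`); the points of
  `Λ_N ∖ S` are interior points of `Sᶜ` in the sense of `StarComponents.lean` (`mem_starInt_of_shell_subset`), so the
  cavity of the origin `starIntComp S 0` is available with its `★`-connected boundaries (Friedli–Velenik Lemma 7.19);
* supports of `★`-chains (`exists_support_of_reflTransGen`: a finite `★`-connected set through both ends meeting every
  sup-norm level in between; `card_ge_of_levels`), whence the PEIERLS COVERING of Grimmett's event `{‖B(x)‖ ≥ n}`:
  **`setOf_exists_chain_subset_biUnion_starAnimals`** — if some `z ∈ Λ_{m+2}` is `★`-chained to `Λ_Nᶜ` through black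
  sites then some `★`-animal `Y ∋ z` (`KestenZhangPeierls.starAnimals z k`) of `k ≥ N - m - 1` sites is entirely black.

The characterisation of the cavity by its white sleeve is the companion `WhiteSleeveCavity.lean`.

## References

* G. Grimmett, *The Random-Cluster Model*, Springer 2006 (`book:grimmett2006-random-cluster-model`): §5.3
  Thm. (5.33)(b), proof sketch pp. 108–110 (the black cluster B(V), the event ‖B(x)‖ ≥ n, (5.35)–(5.36)). [Grimmett2006]
* S. Friedli, Y. Velenik, *Statistical Mechanics of Lattice Systems*, CUP 2017: §7.2.6 (eq. (7.22), Exercise 7.11,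
  Lemma 7.19), App. B.15 Lemma B.82. [FriedliVelenik2017]
* G. Grimmett, *Percolation*, 2nd ed., Springer 1999, §8.6 p. 222 (connected sets through a vertex: the count μ(d)^m).
  [GrimmettPercolation1999]
-/

noncomputable section

open Finset SimpleGraph Relation

namespace Summit.CriticalPhenomena.PercolationContinuityZ3.Theorems.FK

open Literature.Probability.Percolation Literature.Probability.LatticeModels

variable {d : ℕ}

/-! ### Boxes and `★`-steps; first exit of a `★`-chain from a region -/

/-- A `★`-neighbour of a point of `Λ_n` lies in `Λ_{n+1}`. [folklore] -/
theorem mem_box_succ_of_supDist_le_one {n : ℕ} {x y : Site d} (hx : x ∈ box d n) (h : supDist x y ≤ 1) :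
    y ∈ box d (n + 1) := by
  rw [supDist_le_iff] at h
  rw [mem_box] at hx ⊢
  intro i; have := hx i; have := h i; push_cast; omega

/-! ### First exit of a `★`-chain from a region -/

/-- **First exit.** A `★`-chain inside `U` from a point of `R` to a point off `R` has a first step leaving `R`:
points `a ∈ R`, `b ∉ R` with `starRel U a b`, the chain from the start to `a` running inside `U ∩ R`. [folklore] -/
theorem exists_starRel_exit {U R : Set (Site d)} {x y : Site d} (h : ReflTransGen (starRel U) x y) (hx : x ∈ R)
    (hy : y ∉ R) : ∃ a b, a ∈ R ∧ b ∉ R ∧ starRel U a b ∧ ReflTransGen (starRel (U ∩ R)) x a := by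
  revert hx
  refine ReflTransGen.head_induction_on h (fun hx => absurd hx hy) ?_
  intro a c hac _ ih ha
  by_cases hc : c ∈ R
  · obtain ⟨a', b, ha', hb, hstep, hchain⟩ := ih hc
    exact ⟨a', b, ha', hb, hstep, ReflTransGen.head ⟨hac.1, ⟨hac.2.1, ha⟩, ⟨hac.2.2, hc⟩⟩ hchain⟩
  · exact ⟨a, c, ha, hc, hac, ReflTransGen.refl⟩

/-- A `★`-step from a point of `Λ_n` to a point off `Λ_n` lands in the shell `Λ_{n+1} ∖ Λ_n`. [folklore] -/
theorem mem_box_succ_sdiff_of_adj {n : ℕ} {a b : Site d} (ha : a ∈ box d n) (hb : b ∉ box d n)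
    (hab : (zdStar d).Adj a b) : b ∈ box d (n + 1) \ box d n :=
  mem_sdiff.2 ⟨mem_box_succ_of_supDist_le_one ha (zdStar_adj.1 hab).2, hb⟩

/-! ### The shell `Λ_{N+1} ∖ Λ_N` is `★`-connected -/

/-- The shell `Λ_{N+1} ∖ Λ_N` is the exterior `★`-boundary of the box `Λ_N`. [folklore] -/
theorem exBoundary_box_eq_sdiff (N : ℕ) : exBoundary (box d N) = box d (N + 1) \ box d N := by
  ext y
  rw [mem_exBoundary, mem_sdiff]
  constructor
  · rintro ⟨hy, x, hx, hxy⟩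
    exact ⟨mem_box_succ_of_supDist_le_one hx (zdStar_adj.1 hxy).2, hy⟩
  · rintro ⟨hy1, hy⟩
    refine ⟨hy, fun i => max (-(N : ℤ)) (min (N : ℤ) (y i)), ?_, ?_⟩
    · rw [mem_box]
      intro i
      constructor
      · exact le_max_left _ _
      · exact max_le (by omega) (min_le_left _ _)
    · refine zdStar_adj.2 ⟨fun h => hy (h ▸ mem_box.2 fun i => ⟨le_max_left _ _, max_le (by omega) (min_le_left _ _)⟩),
        supDist_le_iff.2 fun i => ?_⟩
      have h1 := (mem_box.1 hy1) i
      push_cast at h1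
      rcases le_total (y i) (N : ℤ) with h | h <;> rcases le_total (-(N : ℤ)) (y i) with h' | h'
      · rw [min_eq_right h, max_eq_right h']; simp
      · rw [min_eq_right h, max_eq_left h']; omega
      · rw [min_eq_left h, max_eq_right (by omega : (-(N : ℤ)) ≤ N)]; omega
      · rw [min_eq_left h, max_eq_right (by omega : (-(N : ℤ)) ≤ N)]; omega

/-- A box is `★`-connected. [cite: FriedliVelenik2017, §7.2.6 (connectedness for d_∞)] -/
theorem starConn_box (N : ℕ) : StarConn ((box d N : Finset (Site d)) : Set (Site d)) := by
  intro x hx y hy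
  rw [box_eq_Icc] at hx hy ⊢
  exact reflTransGen_starRel_Icc hx hy

/-- **The shell `Λ_{N+1} ∖ Λ_N` is `★`-connected** (`d ≥ 2`; Lemma B.82 for the box). [cite: FriedliVelenik2017, App. B.15, Lemma B.82] -/
theorem starConn_shell (hd : 2 ≤ d) (N : ℕ) : StarConn ((box d (N + 1) \ box d N : Finset (Site d)) : Set (Site d)) := by
  rw [← exBoundary_box_eq_sdiff]
  exact starConn_exBoundary (starConn_box N) (RCC.starConn_compl_box hd N)

/-! ### Supports of `★`-chains: animals and the levels they cross -/

/-- Adding a `★`-neighbour of a point of a `★`-connected set keeps it `★`-connected. [folklore] -/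
theorem starConn_insert {S : Set (Site d)} (hS : StarConn S) {c y : Site d} (hc : c ∈ S) (hcy : supDist c y ≤ 1) :
    StarConn (insert y S) := by
  by_cases hyS : y ∈ S
  · rwa [Set.insert_eq_of_mem hyS]
  have hne : c ≠ y := fun h => hyS (h ▸ hc)
  have hstep : starRel (insert y S) c y := ⟨zdStar_adj.2 ⟨hne, hcy⟩, Set.mem_insert_of_mem _ hc, Set.mem_insert _ _⟩
  have hmono : ∀ {a b}, a ∈ S → b ∈ S → ReflTransGen (starRel (insert y S)) a b := fun ha hb =>
    reflTransGen_starRel_mono (Set.subset_insert _ _) (hS _ ha _ hb)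
  intro a ha b hb
  rcases Set.mem_insert_iff.1 ha with rfl | ha' <;> rcases Set.mem_insert_iff.1 hb with rfl | hb'
  · exact ReflTransGen.refl
  · exact (reflTransGen_starRel_symm (ReflTransGen.single hstep)).trans (hmono hc hb')
  · exact (hmono ha' hc).trans (ReflTransGen.single hstep)
  · exact hmono ha' hb'

/-- A `★`-step raises the sup-norm by at most one. [folklore] -/
theorem siteRad_le_succ_of_supDist_le_one {c y : Site d} (h : supDist c y ≤ 1) : siteRad y ≤ siteRad c + 1 :=
  mem_box_iff_siteRad_le.1 (mem_box_succ_of_supDist_le_one (mem_box_iff_siteRad_le.2 le_rfl) h)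

/-- **The support of a `★`-chain**: a chain inside `U` from `x` to `y` is carried by a finite `★`-connected set
`Y ∋ x, y`, all of whose points other than `x` lie in `U`, and which meets every sup-norm level between `‖x‖_∞`
and `‖y‖_∞` (a `★`-step changes the sup-norm by at most one). [folklore] -/
theorem exists_support_of_reflTransGen {U : Set (Site d)} {x y : Site d} (h : ReflTransGen (starRel U) x y) :
    ∃ Y : Finset (Site d), x ∈ Y ∧ y ∈ Y ∧ StarConn (↑Y : Set (Site d)) ∧ (∀ w ∈ Y, w = x ∨ w ∈ U) ∧
      ∀ r : ℕ, siteRad x ≤ r → r ≤ siteRad y → ∃ w ∈ Y, siteRad w = r := by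
  classical
  induction h with
  | refl =>
    refine ⟨{x}, mem_singleton_self x, mem_singleton_self x, ?_, fun w hw => Or.inl (mem_singleton.1 hw),
      fun r h1 h2 => ⟨x, mem_singleton_self x, le_antisymm h1 h2⟩⟩
    intro a ha b hb
    rw [coe_singleton, Set.mem_singleton_iff] at ha hb
    rw [ha, hb]
  | @tail c y' _ hcy ih =>
    obtain ⟨Y, hxY, hcY, hYconn, hYU, hlev⟩ := ih
    have hcy1 : supDist c y' ≤ 1 := (zdStar_adj.1 hcy.1).2
    refine ⟨insert y' Y, mem_insert_of_mem hxY, mem_insert_self _ _, ?_, ?_, ?_⟩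
    · rw [coe_insert]; exact starConn_insert hYconn (mem_coe.2 hcY) hcy1
    · intro w hw
      rcases mem_insert.1 hw with rfl | hw
      · exact Or.inr hcy.2.2
      · exact hYU w hw
    · intro r h1 h2
      by_cases hr : r ≤ siteRad c
      · obtain ⟨w, hw, hwr⟩ := hlev r h1 hr
        exact ⟨w, mem_insert_of_mem hw, hwr⟩
      · have := siteRad_le_succ_of_supDist_le_one hcy1
        exact ⟨y', mem_insert_self _ _, by omega⟩

/-- The support meets at least `‖y‖_∞ + 1 - ‖x‖_∞` points. [folklore] -/
theorem card_ge_of_levels {Y : Finset (Site d)} {x y : Site d}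
    (hlev : ∀ r : ℕ, siteRad x ≤ r → r ≤ siteRad y → ∃ w ∈ Y, siteRad w = r) :
    siteRad y + 1 - siteRad x ≤ Y.card := by
  classical
  have hsub : Finset.Icc (siteRad x) (siteRad y) ⊆ Y.image siteRad := by
    intro r hr
    rw [Finset.mem_Icc] at hr
    obtain ⟨w, hw, hwr⟩ := hlev r hr.1 hr.2
    exact mem_image.2 ⟨w, hw, hwr⟩
  calc siteRad y + 1 - siteRad x = (Finset.Icc (siteRad x) (siteRad y)).card := (Nat.card_Icc _ _).symm
    _ ≤ (Y.image siteRad).card := card_le_card hsub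
    _ ≤ Y.card := card_image_le
/-! ### The black cluster `S` of the shell: basic facts -/

section BlackCluster

variable {N : ℕ} {B : Set (Site d)} {S : Finset (Site d)}

/-- A shell site belongs to the black cluster (trivial chain). [cite: Grimmett2006, §5.3 proof of Thm. (5.33)(b) (V ⊆ B(V))] -/
theorem mem_blackCluster_of_mem_shell
    (hS : ∀ z, z ∈ S ↔ z ∈ box d (N + 1) ∧ ∃ y, y ∉ box d N ∧ ReflTransGen (starRel {w | w ∉ box d N ∨ w ∈ B}) z y)
    {z : Site d} (hz : z ∈ box d (N + 1) \ box d N) : z ∈ S :=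
  (hS z).2 ⟨(mem_sdiff.1 hz).1, z, (mem_sdiff.1 hz).2, ReflTransGen.refl⟩

/-- The black cluster lies in `Λ_{N+1}`. [folklore] -/
theorem blackCluster_subset_box
    (hS : ∀ z, z ∈ S ↔ z ∈ box d (N + 1) ∧ ∃ y, y ∉ box d N ∧ ReflTransGen (starRel {w | w ∉ box d N ∨ w ∈ B}) z y) :
    S ⊆ box d (N + 1) := fun z hz => ((hS z).1 hz).1

/-- A site of the black cluster inside `Λ_N` is black (its chain to `Λ_Nᶜ` has a first step).
[cite: Grimmett2006, §5.3 proof of Thm. (5.33)(b) (the vertices of B(V) ∖ V are black)] -/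
theorem mem_black_of_mem_blackCluster
    (hS : ∀ z, z ∈ S ↔ z ∈ box d (N + 1) ∧ ∃ y, y ∉ box d N ∧ ReflTransGen (starRel {w | w ∉ box d N ∨ w ∈ B}) z y)
    {z : Site d} (hz : z ∈ S) (hzN : z ∈ box d N) : z ∈ B := by
  obtain ⟨-, y, hy, hchain⟩ := (hS z).1 hz
  rcases hchain.cases_head with h | ⟨c, hzc, -⟩
  · exact absurd hzN (h ▸ hy)
  · rcases hzc.2.1 with h | h
    · exact absurd hzN h
    · exact h

/-- A site of `Λ_{N+1}` that is black-or-outside and `★`-adjacent to the black cluster belongs to it.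
[cite: Grimmett2006, §5.3 proof of Thm. (5.33)(b) (definition of B(V))] -/
theorem mem_blackCluster_of_adj
    (hS : ∀ z, z ∈ S ↔ z ∈ box d (N + 1) ∧ ∃ y, y ∉ box d N ∧ ReflTransGen (starRel {w | w ∉ box d N ∨ w ∈ B}) z y)
    {x z : Site d} (hx1 : x ∈ box d (N + 1)) (hx : x ∉ box d N ∨ x ∈ B) (hz : z ∈ S) (hxz : (zdStar d).Adj x z) :
    x ∈ S := by
  by_cases hxN : x ∈ box d N
  · obtain ⟨hz1, y, hy, hchain⟩ := (hS z).1 hz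
    have hzBk : z ∉ box d N ∨ z ∈ B := by
      by_cases hzN : z ∈ box d N
      · exact Or.inr (mem_black_of_mem_blackCluster hS hz hzN)
      · exact Or.inl hzN
    exact (hS x).2 ⟨hx1, y, hy, ReflTransGen.head ⟨hxz, hx, hzBk⟩ hchain⟩
  · exact (hS x).2 ⟨hx1, x, hxN, ReflTransGen.refl⟩

/-- **The black cluster of the shell is `★`-connected** (`d ≥ 2`): every site of it is chained INSIDE it to the shell
(stop its black chain at the first exit from `Λ_N`), and the shell is `★`-connected. [cite: Grimmett2006, §5.3 proof of Thm. (5.33)(b) (B(∂Δ) is an 𝓛-connected set containing ∂Δ)] -/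
theorem starConn_blackCluster (hd : 2 ≤ d)
    (hS : ∀ z, z ∈ S ↔ z ∈ box d (N + 1) ∧ ∃ y, y ∉ box d N ∧ ReflTransGen (starRel {w | w ∉ box d N ∨ w ∈ B}) z y) :
    StarConn (↑S : Set (Site d)) := by
  -- every site of `S` is chained inside `S` to a shell site
  have key : ∀ z ∈ S, ∃ b ∈ box d (N + 1) \ box d N, ReflTransGen (starRel (↑S : Set (Site d))) z b := by
    intro z hz
    obtain ⟨hz1, y, hy, hchain⟩ := (hS z).1 hz
    by_cases hzN : z ∈ box d N
    · obtain ⟨a, b, ha, hb, hab, hza⟩ := exists_starRel_exit (R := (↑(box d N) : Set (Site d))) hchain hzN hy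
      have hbshell : b ∈ box d (N + 1) \ box d N := mem_box_succ_sdiff_of_adj ha hb hab.1
      have hbS : b ∈ S := mem_blackCluster_of_mem_shell hS hbshell
      -- the chain `z ⇝ a` inside `Bk ∩ Λ_N` runs inside `S`
      have hclosed : ∀ a' ∈ (↑S : Set (Site d)), ∀ b', starRel ({w | w ∉ box d N ∨ w ∈ B} ∩ ↑(box d N)) a' b' →
          b' ∈ (↑S : Set (Site d)) := by
        intro a' ha' b' hab'
        have hb'1 : b' ∈ box d (N + 1) := box_mono d (Nat.le_succ N) hab'.2.2.2
        exact mem_coe.2 (mem_blackCluster_of_adj hS hb'1 hab'.2.2.1 (mem_coe.1 ha') hab'.1.symm)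
      have hza' : ReflTransGen (starRel (↑S : Set (Site d))) z a := reflTransGen_starRel_restrict hclosed (mem_coe.2 hz) hza
      have haS : a ∈ S := mem_coe.1 (mem_of_reflTransGen_starRel hza' (mem_coe.2 hz))
      exact ⟨b, hbshell, hza'.tail ⟨hab.1, mem_coe.2 haS, mem_coe.2 hbS⟩⟩
    · exact ⟨z, mem_sdiff.2 ⟨hz1, hzN⟩, ReflTransGen.refl⟩
  have hshell : ∀ b ∈ box d (N + 1) \ box d N, ∀ b' ∈ box d (N + 1) \ box d N,
      ReflTransGen (starRel (↑S : Set (Site d))) b b' := fun b hb b' hb' =>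
    reflTransGen_starRel_mono (fun w hw => mem_coe.2 (mem_blackCluster_of_mem_shell hS (mem_coe.1 hw)))
      (starConn_shell hd N _ (mem_coe.2 hb) _ (mem_coe.2 hb'))
  intro z hz z' hz'
  obtain ⟨b, hb, hzb⟩ := key z (mem_coe.1 hz)
  obtain ⟨b', hb', hzb'⟩ := key z' (mem_coe.1 hz')
  exact (hzb.trans (hshell b hb b' hb')).trans (reflTransGen_starRel_symm hzb')

/-- **Points of `Λ_N` off the black cluster are interior** (a chain in `Sᶜ` to the far region would have to cross the
shell, which lies in `S`). [cite: FriedliVelenik2017, §7.2.6, eq. (7.22)] -/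
theorem mem_starInt_of_shell_subset (hd : 2 ≤ d) (hSbox : S ⊆ box d (N + 1)) (hshell : box d (N + 1) \ box d N ⊆ S)
    {x : Site d} (hxN : x ∈ box d N) (hxS : x ∉ S) : x ∈ starInt S := by
  refine (mem_starInt hd).2 ⟨hxS, fun hext => ?_⟩
  obtain ⟨-, y, hy, hchain⟩ := (mem_starExt_iff hd hSbox).1 hext
  have hyN : y ∉ box d N := fun h => (mem_farSet_iff_not_mem_box.1 hy) (box_mono d (Nat.le_succ N) h)
  obtain ⟨a, b, ha, hb, hab, -⟩ := exists_starRel_exit (R := (↑(box d N) : Set (Site d))) hchain hxN hyN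
  exact hab.2.2 (mem_coe.2 (hshell (mem_box_succ_sdiff_of_adj ha hb hab.1)))

/-- An interior component of the black cluster's complement lies in `Λ_N`. [cite: FriedliVelenik2017, §7.2.6] -/
theorem starIntComp_subset_box (hd : 2 ≤ d) (hSbox : S ⊆ box d (N + 1)) (hshell : box d (N + 1) \ box d N ⊆ S)
    (x : Site d) : starIntComp S x ⊆ box d N := by
  intro z hz
  have hz' := (mem_starInt hd).1 (starIntComp_subset S x hz)
  have hz1 : z ∈ box d (N + 1) := starInt_subset_box hd hSbox (starIntComp_subset S x hz)
  by_contra hzN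
  exact hz'.1 (hshell (mem_sdiff.2 ⟨hz1, hzN⟩))

end BlackCluster
/-! ### The Peierls covering: a black chain from `Λ_{m+2}` to `Λ_Nᶜ` carries a long black `★`-animal -/

/-- **Covering by black animals**: if some `z ∈ Λ_{m+2}` (`m + 2 ≤ N`) is `★`-chained to `Λ_Nᶜ` through
black-or-outside sites, then for some `k ≥ N - m - 1` there is a `★`-connected set `Y ∋ z` of exactly `k` sites
(`Y ∈ starAnimals z k`) all of which are black — stop the chain at its first exit from `Λ_N`; its support is
`★`-connected, black, and crosses every sup-norm level from `‖z‖_∞ ≤ m + 2` to `N`. [cite: Grimmett2006, §5.3 proof of Thm. (5.33)(b), (5.35)–(5.36) (the event ‖B(x)‖ ≥ n and its Peierls estimate)] -/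
theorem setOf_exists_chain_subset_biUnion_starAnimals {m N : ℕ} (hmN : m + 2 ≤ N) :
    {ω : BondConfig (Site d) | ∃ z ∈ box d (m + 2), ∃ y, y ∉ box d N ∧ ReflTransGen (starRel {w | w ∉ box d N ∨
        ∃ e ∈ edgesTouching (zdGraph d) (starBall w), e ∉ ω}) z y} ⊆
      ⋃ z ∈ box d (m + 2), ⋃ k ∈ {k : ℕ | N - m - 1 ≤ k}, ⋃ Y ∈ starAnimals z k,
        ⋂ b ∈ Y, {ω : BondConfig (Site d) | ∃ e ∈ edgesTouching (zdGraph d) (starBall b), e ∉ ω} := by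
  intro ω hω
  obtain ⟨z, hz, y, hy, hchain⟩ := hω
  have hzN : z ∈ (↑(box d N) : Set (Site d)) := mem_coe.2 (box_mono d hmN hz)
  obtain ⟨a, b, ha, hb, hab, hza⟩ := exists_starRel_exit hchain hzN (fun h => hy (mem_coe.1 h))
  -- the support of the chain `z ⇝ a` inside `Bk ∩ Λ_N`
  obtain ⟨Y, hzY, haY, hYconn, hYU, hlev⟩ := exists_support_of_reflTransGen hza
  -- every site of `Y` is black: the sites after `z` by the chain, and `z = a` or `z ∈ Bk ∩ Λ_N` too
  have haBk : a ∉ box d N ∨ ∃ e ∈ edgesTouching (zdGraph d) (starBall a), e ∉ ω := hab.2.1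
  have hblack : ∀ w ∈ Y, ∃ e ∈ edgesTouching (zdGraph d) (starBall w), e ∉ ω := by
    intro w hw
    rcases hYU w hw with rfl | hwU
    · -- `w = z`: either the chain is trivial (`z = a ∈ Bk`) or its first step starts in `Bk`
      rcases hza.cases_head with h | ⟨c, hzc, -⟩
      · subst h
        rcases haBk with h | h
        · exact absurd (mem_coe.1 hzN) h
        · exact h
      · rcases hzc.2.1.1 with h | h
        · exact absurd (mem_coe.1 hzN) h
        · exact h
    · rcases hwU.1 with h | h
      · exact absurd (mem_coe.1 hwU.2) h
      · exact h
  -- the level count: `‖a‖_∞ = N`, `‖z‖_∞ ≤ m + 2`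
  have haN : siteRad a = N := by
    have h1 : siteRad a ≤ N := mem_box_iff_siteRad_le.1 (mem_coe.1 ha)
    have h2 : N + 1 ≤ siteRad b := by
      by_contra h
      exact hb (mem_coe.2 (mem_box_iff_siteRad_le.2 (by omega)))
    have h3 := siteRad_le_succ_of_supDist_le_one (zdStar_adj.1 hab.1).2
    omega
  have hzm : siteRad z ≤ m + 2 := mem_box_iff_siteRad_le.1 hz
  have hcard : N - m - 1 ≤ Y.card := by
    have := card_ge_of_levels hlev
    rw [haN] at this
    omega
  simp only [Set.mem_iUnion, Set.mem_iInter, Set.mem_setOf_eq, exists_prop]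
  exact ⟨z, hz, Y.card, hcard, Y, mem_starAnimals hzY hYconn, fun w hw => hblack w hw⟩

end Summit.CriticalPhenomena.PercolationContinuityZ3.Theorems.FK

end
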